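import Mathlib
import Literature.NumberTheory.Transcendental.RoyCriterion
import Literature.NumberTheory.Transcendental.RoyCriterionProofs
import Summits.Schanuel.Schanuel.Theorems.SoloBlindTwistForcing
import HarnessLib

/-!
# Twisted-order forcing, all Taylor rows (Lemma F′ at `p = 2`, rows `j ≥ 0`)

Corollary of `two_pow_dvd_eval_of_taylorInt_eq_zero` applied to `DʲP` (`D = ∂₀ + X₁∂₁`, Roy's derivation):
if `ord₀ P(w, e^w) ≥ K+1` (`taylorInt n P = 0` for `n ≤ K`) then for every row `j` (trivial for `j > K`)

  `2^{⌈(K+1−j)/2⌉} ∣ (DʲP)(0, −1)`,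

i.e. the `j`-th Taylor coefficient `R_j(−1) := (d/dw)ʲ P(w, −e^w)|_{w=0} = (DʲP)(0,−1)` of the TWISTED function
`P(w, −e^w)` is divisible by `2^{⌈(K+1−j)/2⌉}`.  Consequently a height bound `|(DʲP)(0,−1)| < 2^{⌈(K+1−j)/2⌉}` for
`j ≤ J` forces the twisted order `ord₀ P(w, −e^w) ≥ J+1` — the forcing half of THEOREM S of this seat
(prose: run/shared/lean/ideation/Schanuel/solo-blind/paper/twist.md §1, Lemma F (iv) / F′).  The only input beyond the
row-`0` theorem is `taylorInt n (DʲP) = taylorInt (n+j) P` (`Function.iterate_add_apply`).  [this work]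
-/

noncomputable section

namespace Summit.Schanuel.Schanuel.Theorems

open Literature.NumberTheory.Transcendental

/-- Shifting rows: `taylorInt n (DʲP) = taylorInt (n + j) P`. [this work] -/
theorem taylorInt_iterate_royD (n j : ℕ) (P : MvPolynomial (Fin 2) ℤ) :
    taylorInt n (royD^[j] P) = taylorInt (n + j) P := by
  rw [taylorInt, taylorInt, ← Function.iterate_add_apply]

/-- LEMMA F′ (`p = 2`), row `j`: `ord₀ P(w,e^w) ≥ K+1` ⇒ `2^{⌈(K+1−j)/2⌉} ∣ (DʲP)(0,−1)`. [this work] -/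
theorem two_pow_dvd_eval_iterate_royD (P : MvPolynomial (Fin 2) ℤ) (K j : ℕ)
    (h : ∀ n ≤ K, taylorInt n P = 0) :
    (2 : ℤ) ^ ((K + 1 - j + 1) / 2) ∣ MvPolynomial.eval ![0, -1] (royD^[j] P) := by
  refine two_pow_dvd_eval_of_taylorInt_eq_zero (royD^[j] P) (m := K + 1 - j) fun n hn => ?_
  rw [taylorInt_iterate_royD]
  exact h (n + j) (by omega)

/-- The forcing form: if `ord₀ P(w,e^w) ≥ K+1` and the integer `(DʲP)(0,−1)` is smaller than `2^{⌈(K+1−j)/2⌉}` in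
absolute value, then it vanishes: `(DʲP)(0,−1) = 0`, i.e. the `j`-th Taylor coefficient of `P(w, −e^w)` is `0`. [this work] -/
theorem eval_iterate_royD_eq_zero_of_natAbs_lt (P : MvPolynomial (Fin 2) ℤ) (K j : ℕ)
    (h : ∀ n ≤ K, taylorInt n P = 0)
    (hsmall : (MvPolynomial.eval ![0, -1] (royD^[j] P)).natAbs < 2 ^ ((K + 1 - j + 1) / 2)) :
    MvPolynomial.eval ![0, -1] (royD^[j] P) = 0 := by
  have hd := two_pow_dvd_eval_iterate_royD P K j h
  rcases hd with ⟨c, hc⟩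
  by_contra hne
  have hc0 : c ≠ 0 := by
    rintro rfl
    exact hne (by simpa using hc)
  have : 2 ^ ((K + 1 - j + 1) / 2) ≤ (MvPolynomial.eval ![0, -1] (royD^[j] P)).natAbs := by
    rw [hc, Int.natAbs_mul, Int.natAbs_pow]
    calc 2 ^ ((K + 1 - j + 1) / 2) = (2 : ℤ).natAbs ^ ((K + 1 - j + 1) / 2) * 1 := by simp
      _ ≤ (2 : ℤ).natAbs ^ ((K + 1 - j + 1) / 2) * c.natAbs :=
          Nat.mul_le_mul_left _ (Int.natAbs_pos.mpr hc0)
  exact Nat.lt_irrefl _ (lt_of_le_of_lt this hsmall)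

end Summit.Schanuel.Schanuel.Theorems
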